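import Summits.ABC.ABC.Theses.TwistAmplification
import Literature.NumberTheory.EllipticCurves.SzpiroFreyProofs
import Literature.NumberTheory.DiophantineGeometry.AbcWave0SUnitProofs
import HarnessLib

/-!
# Route TwistAmplification — `Assembly` (item stmt-ABC-10440)

The assembly of route `TwistAmplification` of summit `ABC`:

`TwistAmplificationLemma → QuadraticTwistInvariants → ModerateWindowCount → ABC`
(`Summit.ABC.ABC.Theses.TwistAmplification.Assembly`), proved unconditionally (the three route items
are its hypotheses; nothing else is assumed).

Proof (Frey bookkeeping, Bombieri–Gubler *Heights* (2006) Thm. 12.5.12 (c) ⟹ (a) pattern, with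
Mahler's `S`-unit finiteness for the small conductors):

* `TwistAmplificationAssembly.cofinite_genSzpiro` — for `σ' > 6` put `σ := (6 + σ')/2 ∈ (6, σ')`;
  the moderate-window count at `σ` (`ModerateWindowCount`) fed into `TwistAmplificationLemma`
  (applied to `QuadraticTwistInvariants`) gives `N₀` with `max(|Δ|, |c₄|³) ≤ N^{σ'}` for every
  minimal integral model with `c₄ ≠ 0`, `c₆ ≠ 0` and conductor `N ≥ N₀` (COFINITE generalized
  Szpiro beyond `σ'`).
* `TwistAmplificationAssembly.exists_frey_model` — every abc triple `(a, b, c)` with `a ≠ b` carries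
  a global minimal integral Frey model `W₀` (B–G (12.17) `freyIntModel a b` if `16 ∤ abc`, (12.18)
  `freyIntModel₂ A B` for the arrangement `A ≡ −1 (4)`, `16 ∣ B` of `exists_arrangement` if
  `16 ∣ abc`; all from `Literature.NumberTheory.EllipticCurves.SzpiroFreyProofs`) with
  `N ∣ 2¹⁰ rad(abc)`, `c² ≤ 2|c₄|`, and IN ADDITION `c₆ ≠ 0`
  (`c₆ = −32 (B−A)(2A+B)(A+2B)` resp. `2c₆ = −(B−A)(2A+B)(A+2B)`, non-zero off the triple
  `(1, 1, 2)`) and `p ∣ N` for every odd prime `p ∣ abc` (bad reduction at the primes of the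
  minimal discriminant: `conductorExponent_ne_zero_of_dvd_Δ`).
* `TwistAmplificationAssembly.abc_of_cofinite_genSzpiro` — given `ε > 0` take `σ' := 6 + 6ε` and its
  `N₀`. Large conductor `N ≥ N₀`: `c⁶ ≤ 8|c₄|³ ≤ 8 N^{6+6ε} ≤ 8 (2¹⁰ rad)^{6+6ε}`, sixth root. Small
  conductor `N < N₀`: every prime of `abc` is `2` or divides `N`, so
  `primeFactors(abc) ⊆ [0, ⌈N₀⌉₊+3)`
  and by Mahler 1933 (`finite_setOf_isABCTriple_primeFactors_subset_holds`, PROVED in the tree) only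
  finitely many triples occur, whence `c ≤ B`. The triple `(1, 1, 2)` (`a = b`) is bounded by hand.
  The constant `max(M^{1/6}, B, 2) + 1` serves the strict `<` form of `ABC`.
* `twistAmplification_assembly_proof` — the item, literally the route decl.

No new definitions; no named-fact hypotheses (the result is conditional only on the route items
built into the statement of `Assembly`). Sources: Bombieri–Gubler 2006, Ex. 12.5.10 and
Thm. 12.5.12; Mahler 1933 (`S`-unit equation); Silverman AEC VII.5.1, VIII.11.
-/

noncomputable section

open UniqueFactorizationMonoid IsDedekindDomain WeierstrassCurve Rat.HeightOneSpectrum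
open Literature.NumberTheory.EllipticCurves Literature.NumberTheory.DiophantineGeometry
open Summit.ABC.ABC.Theses.TwistAmplification

-- `Summit.<Summit>.<Problem>` is the mandated summit-side namespace (CONVENTIONS §2); for the
-- single-conjunct summit `ABC` the two coincide, so the duplicate `ABC.ABC` is deliberate.
set_option linter.dupNamespace false

namespace Summit.ABC.ABC.Theorems

/-! ### Bad primes divide the conductor -/

/-- For an integral model `W₀/ℤ` of an elliptic curve over `ℚ` that is minimal at every prime, every
prime `p ∣ Δ(W₀)` divides the conductor `N` (bad reduction: `f_p ≠ 0`, Silverman AEC VII.5.1(a),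
B–G 12.5.9(d); here from `conductorExponent_ne_zero_of_dvd_Δ` and the factorisation
`N = ∏ p^{f_p}`).
[folklore] -/
theorem TwistAmplificationAssembly.dvd_conductorNorm_of_dvd_Δ {W₀ : WeierstrassCurve ℤ}
    [(W₀.baseChange ℚ).IsElliptic]
    (hmin : ∀ v : HeightOneSpectrum ℤ, (W₀.baseChange ℚ).IsMinimalAt v)
    {p : ℕ} (hp : p.Prime) (h : (p : ℤ) ∣ W₀.Δ) :
    p ∣ (W₀.baseChange ℚ).conductorNorm ℤ := by
  refine Nat.dvd_of_factorization_pos ?_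
  rw [factorization_conductorNorm_primesEquiv_symm (W₀.baseChange ℚ) ⟨p, hp⟩]
  refine conductorExponent_ne_zero_of_dvd_Δ (hmin _) ?_
  rw [Literature.NumberTheory.EllipticCurves.Rat.natGenerator_primesEquiv_symm]
  exact h

/-! ### `c₆` of the two integral Frey models -/

/-- `c₆` of B–G (12.17) `y² = x³ + (B − A) x² − AB x`: `c₆ = −32 (B − A)(2A + B)(A + 2B)`.
[cite: BombieriGubler2006, Ex. 12.5.10] -/
theorem TwistAmplificationAssembly.freyIntModel_c₆ (A B : ℤ) :
    (freyIntModel A B).c₆ = -32 * ((B - A) * (2 * A + B) * (A + 2 * B)) := by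
  simp only [freyIntModel, WeierstrassCurve.c₆, WeierstrassCurve.b₂, WeierstrassCurve.b₄,
    WeierstrassCurve.b₆]
  ring

/-- `c₆` of B–G (12.18) `y² + xy = x³ + ((B − A − 1)/4) x² − (AB/16) x` under `4 ∣ B − A − 1`,
`16 ∣ AB`: `2 c₆' = −(B − A)(2A + B)(A + 2B)` (i.e. `c₆' = 2⁻⁶ c₆` of (12.17)).
[cite: BombieriGubler2006, Ex. 12.5.10] -/
theorem TwistAmplificationAssembly.two_mul_freyIntModel₂_c₆ {A B : ℤ} (h4 : 4 ∣ B - A - 1)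
    (h16 : 16 ∣ A * B) :
    2 * (freyIntModel₂ A B).c₆ = -((B - A) * (2 * A + B) * (A + 2 * B)) := by
  obtain ⟨d, hd⟩ := h4
  obtain ⟨e, he⟩ := h16
  have hd' : (B - A - 1) / 4 = d := by rw [hd]; simp
  have he' : A * B / 16 = e := by rw [he]; simp
  simp only [freyIntModel₂, WeierstrassCurve.c₆, WeierstrassCurve.b₂, WeierstrassCurve.b₄,
    WeierstrassCurve.b₆, hd', he']
  linear_combination
    (2 * (B - A) ^ 2 + 9 * A * B + 2 * (1 + 4 * d) * ((B - A) + (1 + 4 * d))) * hd +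
      9 * (1 + 4 * d) * he

/-! ### The minimal Frey model of an abc triple, with `c₆ ≠ 0` and the bad odd primes -/

/-- **B–G Ex. 12.5.10 / Thm. 12.5.12 (c) ⟹ (a), packaged with two extra clauses.** Every abc
triple `(a, b, c)` with `a ≠ b` carries a global minimal Weierstrass equation `W₀` over `ℤ` of a
Frey curve — (12.17) for `(A, B) = (a, b)` if `16 ∤ abc`, (12.18) for the arrangement of
`exists_arrangement` if `16 ∣ abc` — with `cond ∣ 2¹⁰ rad(abc)`, `c² ≤ 2|c₄(W₀)|`, `c₆(W₀) ≠ 0`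
(the factors `B − A`, `2A + B`, `A + 2B` of `c₆` vanish for no such arrangement), and every odd
prime of `abc` dividing the conductor (it divides `Δ(W₀)`, hence is of bad reduction).
[cite: BombieriGubler2006, Thm. 12.5.12] -/
theorem TwistAmplificationAssembly.exists_frey_model {a b c : ℕ} (h : IsABCTriple a b c)
    (hab : a ≠ b) :
    ∃ W₀ : WeierstrassCurve ℤ, (W₀.baseChange ℚ).IsElliptic ∧
      (∀ v : HeightOneSpectrum ℤ, (W₀.baseChange ℚ).IsMinimalAt v) ∧
      (W₀.baseChange ℚ).conductorNorm ℤ ∣ 2 ^ 10 * rad a b c ∧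
      (c : ℤ) ^ 2 ≤ 2 * |W₀.c₄| ∧ W₀.c₆ ≠ 0 ∧
      ∀ p : ℕ, p.Prime → p ∣ a * b * c → p ≠ 2 →
        p ∣ (W₀.baseChange ℚ).conductorNorm ℤ := by
  have h' := h
  obtain ⟨ha, hb, habc, hcop⟩ := h'
  have hc : 0 < c := by omega
  have habc0 : a * b * c ≠ 0 := by positivity
  by_cases h16 : 16 ∣ a * b * c
  · obtain ⟨A, B, hAB, hA, hB, hprod, hquad⟩ := exists_arrangement h h16
    have h0 : A * B * (A + B) ≠ 0 := by
      rw [← Int.natAbs_ne_zero, hprod]; exact habc0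
    have h4 : 4 ∣ B - A - 1 := by
      have : B - A - 1 = B - (A + 1) := by ring
      rw [this]; exact dvd_sub (dvd_trans (by norm_num) hB) hA
    have h16' : 16 ∣ A * B := dvd_mul_of_dvd_right hB _
    haveI hE := isElliptic_freyIntModel₂ h0 h4 h16'
    have hmin : ∀ v : HeightOneSpectrum ℤ,
        ((freyIntModel₂ A B).baseChange ℚ).IsMinimalAt v :=
      isMinimalAt_freyIntModel₂ hAB hA hB
    refine ⟨freyIntModel₂ A B, hE, hmin, ?_, ?_, ?_, ?_⟩
    · rw [rad_def, ← hprod]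
      exact (conductorNorm_freyIntModel₂_dvd hAB h0 hA hB).trans (dvd_mul_left _ _)
    · rw [freyIntModel₂_c₄ h4 h16']
      have hq : (0 : ℤ) ≤ A ^ 2 + A * B + B ^ 2 := by
        nlinarith [sq_nonneg (A + B), sq_nonneg A, sq_nonneg B]
      rw [abs_of_nonneg hq, hquad]
      nlinarith [sq_nonneg (a : ℤ), sq_nonneg (b : ℤ)]
    · -- `c₆ ≠ 0`: `2 c₆ = −(B − A)(2A + B)(A + 2B)`, and no factor vanishes when
      -- `4 ∣ A + 1`, `16 ∣ B`
      intro hc6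
      have h2 := TwistAmplificationAssembly.two_mul_freyIntModel₂_c₆ h4 h16'
      rw [hc6, mul_zero, eq_comm, neg_eq_zero] at h2
      obtain ⟨k, hk⟩ := hA
      obtain ⟨l, hl⟩ := hB
      rcases mul_eq_zero.mp h2 with h2 | h2
      · rcases mul_eq_zero.mp h2 with h2 | h2 <;> omega
      · omega
    · -- odd primes of `abc` divide `Δ' = (AB/16)² (A + B)²`, hence the conductor
      intro p hp hpabc hp2
      refine TwistAmplificationAssembly.dvd_conductorNorm_of_dvd_Δ hmin hp ?_
      have hpm : (p : ℤ) ∣ A * B * (A + B) := by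
        have : (p : ℤ) ∣ ((A * B * (A + B)).natAbs : ℤ) := by rw [hprod]; exact_mod_cast hpabc
        exact Int.dvd_natAbs.mp this
      have hpint : Prime (p : ℤ) := Nat.prime_iff_prime_int.mp hp
      rw [freyIntModel₂_Δ h4 h16']
      obtain ⟨e, he⟩ := h16'
      have he' : A * B / 16 = e := by rw [he]; simp
      rw [he']
      rcases hpint.dvd_or_dvd hpm with h1 | h1
      · rw [he] at h1
        rcases hpint.dvd_or_dvd h1 with h3 | h3
        · exact absurd (eq_two_of_dvd_sixteen hp h3) hp2
        · exact dvd_mul_of_dvd_left (dvd_pow h3 two_ne_zero) _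
      · exact dvd_mul_of_dvd_right (dvd_pow h1 two_ne_zero) _
  · have hab' : IsCoprime (a : ℤ) (b : ℤ) := Nat.isCoprime_iff_coprime.mpr hcop
    have hP : (a : ℤ) * b * (a + b) = ((a * b * c : ℕ) : ℤ) := by
      rw [← habc]; push_cast; ring
    have h0 : (a : ℤ) * b * (a + b) ≠ 0 := by rw [hP]; exact_mod_cast habc0
    have h16' : ¬ (16 : ℤ) ∣ (a : ℤ) * b * (a + b) := by
      rw [hP]; exact_mod_cast mt Int.natCast_dvd_natCast.mp h16
    haveI hE := isElliptic_freyIntModel h0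
    have hmin : ∀ v : HeightOneSpectrum ℤ,
        ((freyIntModel (a : ℤ) b).baseChange ℚ).IsMinimalAt v :=
      isMinimalAt_freyIntModel hab' h0 h16'
    refine ⟨freyIntModel a b, hE, hmin, ?_, ?_, ?_, ?_⟩
    · have := conductorNorm_freyIntModel_dvd hab' h0 h16'
      rwa [hP, Int.natAbs_natCast, ← rad_def] at this
    · rw [freyIntModel_c₄]
      have hq : (0 : ℤ) ≤ (a : ℤ) ^ 2 + a * b + b ^ 2 := by positivity
      rw [abs_of_nonneg (by positivity), ← habc]
      push_cast
      nlinarith [hq, sq_nonneg ((a : ℤ) - b)]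
    · -- `c₆ = −32 (b − a)(2a + b)(a + 2b) ≠ 0` as `a ≠ b`, `a, b > 0`
      rw [TwistAmplificationAssembly.freyIntModel_c₆]
      have h1 : (b : ℤ) - a ≠ 0 := sub_ne_zero.mpr (by exact_mod_cast (Ne.symm hab))
      have h2 : (2 * a + b : ℤ) ≠ 0 := by positivity
      have h3 : (a + 2 * b : ℤ) ≠ 0 := by positivity
      exact mul_ne_zero (by norm_num) (mul_ne_zero (mul_ne_zero h1 h2) h3)
    · -- every prime of `abc` divides `Δ = 16 (ab(a + b))²`, hence the conductor
      intro p hp hpabc _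
      refine TwistAmplificationAssembly.dvd_conductorNorm_of_dvd_Δ hmin hp ?_
      rw [freyIntModel_Δ, hP]
      exact dvd_mul_of_dvd_right (dvd_pow (Int.natCast_dvd_natCast.mpr hpabc) two_ne_zero) _

/-! ### Step 1: the cofinite generalized Szpiro bound from the three route items -/

/-- **Cofinite generalized Szpiro from the route items.** Under `TwistAmplificationLemma`,
`QuadraticTwistInvariants` and `ModerateWindowCount`: for every `σ' > 6` there is `N₀` such that
every minimal integral model with `c₄ ≠ 0`, `c₆ ≠ 0` and conductor `N ≥ N₀` has
`max(|Δ|, |c₄|³) ≤ N^{σ'}`. Proof: window count at `σ := (6 + σ')/2 ∈ (6, σ')`, then amplification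
to `σ'`. [folklore] -/
theorem TwistAmplificationAssembly.cofinite_genSzpiro (hAmp : TwistAmplificationLemma)
    (hTwist : QuadraticTwistInvariants) (hCount : ModerateWindowCount) {σ' : ℝ}
    (hσ' : 6 < σ') :
    ∃ N₀ : ℝ, ∀ W₀ : WeierstrassCurve ℤ, (W₀.baseChange ℚ).IsElliptic →
      (∀ v : HeightOneSpectrum ℤ, (W₀.baseChange ℚ).IsMinimalAt v) →
        W₀.c₄ ≠ 0 → W₀.c₆ ≠ 0 → N₀ ≤ (((W₀.baseChange ℚ).conductorNorm ℤ : ℕ) : ℝ) →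
          ((max |W₀.Δ| (|W₀.c₄| ^ 3) : ℤ) : ℝ) ≤
            (((W₀.baseChange ℚ).conductorNorm ℤ : ℕ) : ℝ) ^ σ' := by
  obtain ⟨κ, δ, C, hκ, hκσ, hδ, hcount⟩ := hCount ((6 + σ') / 2) (by linarith)
  exact hAmp hTwist κ ((6 + σ') / 2) δ C hκ hκσ hδ hcount σ' (by linarith)

/-! ### Step 2: cofinite generalized Szpiro (all exponents `> 6`) implies abc -/

/-- **Frey bookkeeping (B–G Thm. 12.5.12 (c) ⟹ (a) pattern) + Mahler.** If for every `σ' > 6` there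
is `N₀` with `max(|Δ|, |c₄|³) ≤ N^{σ'}` for all minimal integral models with `c₄ c₆ ≠ 0` and
conductor `N ≥ N₀`, then the abc conjecture holds (stated as the displayed sentence of `ABC`,
strict form with `0 < C`). For `ε > 0` use `σ' = 6 + 6ε`: abc triples
whose minimal Frey model has conductor `≥ N₀` satisfy `c⁶ ≤ 8|c₄|³ ≤ 8 (2¹⁰ rad(abc))^{6+6ε}`; those
of conductor `< N₀` have all prime factors of `abc` below `⌈N₀⌉₊ + 3` (odd bad primes divide `N`),
hence are finitely many (Mahler 1933, `finite_setOf_isABCTriple_primeFactors_subset_holds`); the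
triple `(1, 1, 2)` is treated apart. [cite: BombieriGubler2006, Thm. 12.5.12] -/
theorem TwistAmplificationAssembly.abc_of_cofinite_genSzpiro
    (hcof : ∀ σ' : ℝ, 6 < σ' → ∃ N₀ : ℝ, ∀ W₀ : WeierstrassCurve ℤ,
      (W₀.baseChange ℚ).IsElliptic →
        (∀ v : HeightOneSpectrum ℤ, (W₀.baseChange ℚ).IsMinimalAt v) →
          W₀.c₄ ≠ 0 → W₀.c₆ ≠ 0 → N₀ ≤ (((W₀.baseChange ℚ).conductorNorm ℤ : ℕ) : ℝ) →
            ((max |W₀.Δ| (|W₀.c₄| ^ 3) : ℤ) : ℝ) ≤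
              (((W₀.baseChange ℚ).conductorNorm ℤ : ℕ) : ℝ) ^ σ') :
    ∀ ε : ℝ, 0 < ε → ∃ C : ℝ, 0 < C ∧
      ∀ a b c : ℕ, IsABCTriple a b c →
        (c : ℝ) < C * ((rad a b c : ℕ) : ℝ) ^ (1 + ε) := by
  intro ε hε
  obtain ⟨N₀, hN₀⟩ := hcof (6 + 6 * ε) (by linarith)
  -- the large-conductor constant
  set M : ℝ := 8 * ((2 : ℝ) ^ 10) ^ (6 + 6 * ε) with hMdef
  have hM0 : 0 ≤ M := by positivity
  -- the small-conductor bound (Mahler)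
  set S : Finset ℕ := Finset.range (⌈N₀⌉₊ + 3) with hSdef
  have hfin : {t : ℕ × ℕ × ℕ | IsABCTriple t.1 t.2.1 t.2.2 ∧
      (t.1 * t.2.1 * t.2.2).primeFactors ⊆ S}.Finite :=
    finite_setOf_isABCTriple_primeFactors_subset_holds S
  obtain ⟨B, hB⟩ := (hfin.image (fun t : ℕ × ℕ × ℕ ↦ t.2.2)).bddAbove
  set C₀ : ℝ := max (max (M ^ (1 / 6 : ℝ)) (B : ℝ)) 2 with hC₀def
  have hC₀2 : 2 ≤ C₀ := le_max_right _ _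
  refine ⟨C₀ + 1, by linarith, fun a b c h ↦ ?_⟩
  set R : ℝ := ((rad a b c : ℕ) : ℝ) with hRdef
  have hR1 : 1 ≤ R := by
    rw [hRdef, rad_def]; exact_mod_cast Nat.radical_pos _
  have hR0 : 0 ≤ R := zero_le_one.trans hR1
  have hRpow1 : 1 ≤ R ^ (1 + ε) := Real.one_le_rpow hR1 (by linarith)
  suffices hmain : (c : ℝ) ≤ C₀ * R ^ (1 + ε) by
    calc (c : ℝ) ≤ C₀ * R ^ (1 + ε) := hmain
      _ < C₀ * R ^ (1 + ε) + R ^ (1 + ε) := lt_add_of_pos_right _ (by linarith)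
      _ = (C₀ + 1) * R ^ (1 + ε) := by ring
  have hC₀R : C₀ ≤ C₀ * R ^ (1 + ε) := le_mul_of_one_le_right (by linarith) hRpow1
  by_cases hab : a = b
  · -- the triple `(1, 1, 2)`
    obtain ⟨-, -, habc, hcop⟩ := h
    subst hab
    have ha1 : a = 1 := by simpa using hcop
    subst ha1
    have hc2 : (c : ℝ) = 2 := by rw [← habc]; norm_num
    linarith
  obtain ⟨W₀, hE, hmin, hN, hc₄, hc₆, hdvd⟩ :=
    TwistAmplificationAssembly.exists_frey_model h hab
  haveI := hE
  have hc : 0 < c := by obtain ⟨ha, -, habc, -⟩ := h; omega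
  set N : ℝ := (((W₀.baseChange ℚ).conductorNorm ℤ : ℕ) : ℝ) with hNdef
  by_cases hsmall : N < N₀
  · -- small conductor: all prime factors of `abc` lie in `S`, so `c ≤ B`
    have hmem : (a, b, c) ∈ {t : ℕ × ℕ × ℕ | IsABCTriple t.1 t.2.1 t.2.2 ∧
        (t.1 * t.2.1 * t.2.2).primeFactors ⊆ S} := by
      refine ⟨h, fun p hp ↦ ?_⟩
      have hpp : p.Prime := Nat.prime_of_mem_primeFactors hp
      have hpd : p ∣ a * b * c := Nat.dvd_of_mem_primeFactors hp
      rw [hSdef, Finset.mem_range]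
      by_cases hp2 : p = 2
      · omega
      have hpN : p ∣ (W₀.baseChange ℚ).conductorNorm ℤ := hdvd p hpp hpd hp2
      have hNpos : 0 < (W₀.baseChange ℚ).conductorNorm ℤ := conductorNorm_pos_holds _
      have hple : (p : ℝ) ≤ N := by rw [hNdef]; exact_mod_cast Nat.le_of_dvd hNpos hpN
      have hplt : (p : ℝ) < (⌈N₀⌉₊ : ℝ) :=
        (hple.trans_lt hsmall).trans_le (Nat.le_ceil _)
      have : p < ⌈N₀⌉₊ := by exact_mod_cast hplt
      omega
    have hcB : c ≤ B := hB (Set.mem_image_of_mem (fun t : ℕ × ℕ × ℕ ↦ t.2.2) hmem)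
    have hcB' : (c : ℝ) ≤ C₀ :=
      ((Nat.cast_le.mpr hcB).trans (le_max_right _ _)).trans (le_max_left _ _)
    exact hcB'.trans hC₀R
  · -- large conductor: `c⁶ ≤ 8 |c₄|³ ≤ 8 N^{6+6ε} ≤ M rad^{6+6ε}`
    push Not at hsmall
    have hc₄0 : W₀.c₄ ≠ 0 := by
      intro h0
      rw [h0, abs_zero, mul_zero] at hc₄
      have : (0 : ℤ) < (c : ℤ) ^ 2 := by positivity
      linarith
    have key := hN₀ W₀ hE hmin hc₄0 hc₆ hsmall
    have h1 : |(W₀.c₄ : ℝ)| ^ 3 ≤ N ^ (6 + 6 * ε) := by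
      have key' : max |(W₀.Δ : ℝ)| (|(W₀.c₄ : ℝ)| ^ 3) ≤ N ^ (6 + 6 * ε) := by
        rw [hNdef]; exact_mod_cast key
      exact le_of_max_le_right key'
    have h2 : N ≤ 2 ^ 10 * R := by
      have := Nat.le_of_dvd (mul_pos (by positivity) (by rw [rad_def]; exact Nat.radical_pos _)) hN
      rw [hNdef, hRdef]; exact_mod_cast this
    have hN0 : 0 ≤ N := by rw [hNdef]; positivity
    have h3 : (c : ℝ) ^ 6 ≤ M * R ^ (6 + 6 * ε) := by
      have hc2 : (c : ℝ) ^ 2 ≤ 2 * |(W₀.c₄ : ℝ)| := by exact_mod_cast hc₄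
      calc (c : ℝ) ^ 6 = ((c : ℝ) ^ 2) ^ 3 := by ring
        _ ≤ (2 * |(W₀.c₄ : ℝ)|) ^ 3 := pow_le_pow_left₀ (by positivity) hc2 3
        _ = 8 * |(W₀.c₄ : ℝ)| ^ 3 := by ring
        _ ≤ 8 * N ^ (6 + 6 * ε) := by linarith
        _ ≤ 8 * (2 ^ 10 * R) ^ (6 + 6 * ε) := by gcongr
        _ = M * R ^ (6 + 6 * ε) := by
            rw [hMdef, Real.mul_rpow (by positivity) hR0]; ring
    have h5 : (c : ℝ) = ((c : ℝ) ^ 6) ^ (1 / 6 : ℝ) := by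
      rw [← Real.rpow_natCast (c : ℝ) 6, ← Real.rpow_mul (by positivity)]; norm_num
    have h6 : ((c : ℝ) ^ 6) ^ (1 / 6 : ℝ) ≤ (M * R ^ (6 + 6 * ε)) ^ (1 / 6 : ℝ) :=
      Real.rpow_le_rpow (by positivity) h3 (by norm_num)
    have h7 : (M * R ^ (6 + 6 * ε)) ^ (1 / 6 : ℝ) = M ^ (1 / 6 : ℝ) * R ^ (1 + ε) := by
      rw [Real.mul_rpow hM0 (by positivity), ← Real.rpow_mul hR0,
        show (6 + 6 * ε) * (1 / 6 : ℝ) = 1 + ε by ring]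
    have h8 : (c : ℝ) ≤ M ^ (1 / 6 : ℝ) * R ^ (1 + ε) := by rw [h5]; exact h6.trans_eq h7
    have hMC : M ^ (1 / 6 : ℝ) ≤ C₀ := (le_max_left _ _).trans (le_max_left _ _)
    exact h8.trans (mul_le_mul_of_nonneg_right hMC (by positivity))

/-! ### The item -/

/-- **Item stmt-ABC-10440 (`Assembly` of route `TwistAmplification`).**
`TwistAmplificationLemma → QuadraticTwistInvariants → ModerateWindowCount → ABC`: the
moderate-window count, amplified along quadratic-twist orbits (`TwistAmplificationLemma` applied
to the Tate-type twist facts `QuadraticTwistInvariants`), gives cofinite generalized Szpiro with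
every exponent `> 6`
(`cofinite_genSzpiro`), and the Frey curve with Mahler's `S`-unit finiteness for the small
conductors turns that into the abc conjecture (`abc_of_cofinite_genSzpiro`; Bombieri–Gubler 2006,
Thm. 12.5.12 (c) ⟹ (a) pattern). [cite: BombieriGubler2006, Thm. 12.5.12] -/
theorem twistAmplification_assembly_proof : Summit.ABC.ABC.Theses.TwistAmplification.Assembly := by
  unfold Summit.ABC.ABC.Theses.TwistAmplification.Assembly _root_.ABC Literature.Abc.ABCConjecture
  intro hAmp hTwist hCount
  exact TwistAmplificationAssembly.abc_of_cofinite_genSzpiro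
    fun σ' hσ' ↦ TwistAmplificationAssembly.cofinite_genSzpiro hAmp hTwist hCount hσ'

end Summit.ABC.ABC.Theorems
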